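import Summits.AtomisticToContinuum.BoseEinsteinCondensation.Theorems.BECGroundStateSOSPeriodicIRBoundDefs

/-!
# Route `BECGroundStateSOS`, crux `PeriodicIRBound` (stmt-AtomisticToContinuum-3972), line
# `linear-ph-floor-wagner` — stub 6 `stub_hardCore : HardCoreHalf` (the non-integrable half)

The NON-INTEGRABLE half of the crux (`∫v = ⊤`: hard cores, non-`L¹` spikes) as reshaped by the lead
after wave 1: given

* the hard-core (Jastrow/Dyson-dressed) Wagner–Feynman moment bound in WINDOW form, for every window
  constant `C` some `A, ρ₁` with `HardCoreWagnerFeynmanWith v C A ρ₁` (`γ_N(k)·θ ≤ A(‖p‖² + ρ)` for the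
  dual-lattice modes `p = 2πk/L_N` with `‖p‖² ≤ Cρ`, eventually in `N`, `ρ < ρ₁`), and
* the linear particle–hole floor `C⁺` for `v` (`LinearFloorFor v`),

the crux for `v` in γ-form (`GroundIRBoundFor v`) is window arithmetic, the `∫v = ⊤` twin of
`TransferArith`: `‖k‖_∞ ≤ κ√ρL_N ⇒ ‖p‖² ≤ 12π²κ²ρ`; floor and moment bound at `C := 12π²κ²`; the floor
supplies `θ := 2θ₀√ρ‖p‖`; the moment bound gives `γ_N(k) ≤ A(‖p‖² + ρ)/(2θ₀√ρ‖p‖) ≤ C'√ρ L_N/‖k‖_∞`,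
`C' = A(6πκ² + 1/(2π))/(2θ₀)`, using `‖p‖ ≥ 2π‖k‖_∞/L_N`, for `ρ < min ρ₀ ρ₁`.
-/

noncomputable section

open scoped BigOperators ENNReal
open Filter MeasureTheory

namespace Summit.AtomisticToContinuum.BoseEinsteinCondensation.Cruxes.PeriodicIRBound.LinearPhFloorWagner

open Literature.MathematicalPhysics.QuantumManyBody.BoseGas
open Summit.AtomisticToContinuum.BoseEinsteinCondensation.Theorems.PeriodicIRBound.Negative
  (IRBoundFor InWindow groundOccupation GroundIRBoundWith irBoundFor_iff_ground)
open Summit.AtomisticToContinuum.BoseEinsteinCondensation.Theorems.GaussianDominationCan.Negative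
  (one_le_norm_intVec)

/-! ## Window arithmetic -/

/-- Coordinates of a dual-lattice vector. [folklore] -/
private theorem latticeVec_apply' (c : ℝ) (k : Fin 3 → ℤ) (j : Fin 3) :
    latticeVec c k j = c * (k j : ℝ) := rfl

/-- `|c| · ‖k‖_∞ ≤ ‖latticeVec c k‖` (each coordinate is bounded by the Euclidean norm). [folklore] -/
private theorem abs_mul_norm_intVec_le_norm_latticeVec (c : ℝ) (k : Fin 3 → ℤ) :
    |c| * ‖(fun j => (k j : ℝ))‖ ≤ ‖latticeVec c k‖ := by
  have h : ‖(fun j => (k j : ℝ))‖ ≤ |c|⁻¹ * ‖latticeVec c k‖ ∨ c = 0 := by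
    by_cases hc : c = 0
    · exact Or.inr hc
    · refine Or.inl ((pi_norm_le_iff_of_nonneg (by positivity)).2 fun j => ?_)
      have h1 : ‖latticeVec c k j‖ ≤ ‖latticeVec c k‖ := PiLp.norm_apply_le _ j
      rw [latticeVec_apply', norm_mul, Real.norm_eq_abs] at h1
      rw [le_inv_mul_iff₀ (abs_pos.2 hc)]
      exact h1
  rcases h with h | h
  · by_cases hc : c = 0
    · simp [hc]
    · calc |c| * ‖(fun j => (k j : ℝ))‖ ≤ |c| * (|c|⁻¹ * ‖latticeVec c k‖) := by gcongr
        _ = ‖latticeVec c k‖ := by field_simp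
  · simp [h]

/-- `‖latticeVec c k‖² ≤ 3 c² ‖k‖_∞²` (three coordinates, each at most `|c|‖k‖_∞`). [folklore] -/
private theorem norm_latticeVec_sq_le (c : ℝ) (k : Fin 3 → ℤ) :
    ‖latticeVec c k‖ ^ 2 ≤ 3 * c ^ 2 * ‖(fun j => (k j : ℝ))‖ ^ 2 := by
  rw [EuclideanSpace.norm_eq, Real.sq_sqrt (Finset.sum_nonneg fun j _ => by positivity)]
  have hj : ∀ j, ‖latticeVec c k j‖ ^ 2 ≤ c ^ 2 * ‖(fun j => (k j : ℝ))‖ ^ 2 := by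
    intro j
    have h1 : |(k j : ℝ)| ≤ ‖(fun j => (k j : ℝ))‖ := by
      have := norm_le_pi_norm (fun j => (k j : ℝ)) j
      rwa [Real.norm_eq_abs] at this
    rw [latticeVec_apply', norm_mul, Real.norm_eq_abs, Real.norm_eq_abs, mul_pow, sq_abs]
    gcongr
  rw [Fin.sum_univ_three]
  linarith [hj 0, hj 1, hj 2]

/-- **The real arithmetic of the transfer.** With `P = ‖p‖ > 0`, `s = √ρ > 0`, the window
`P² ≤ 12π²κ²s²` and the lattice bound `2π m/L ≤ P` (`m = ‖k‖_∞ > 0`):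
`A(P² + s²)/(2θ s P) ≤ A(6πκ² + 1/(2π))/(2θ) · sL/m`. [folklore] -/
private theorem transfer_arith {A θ κ P s L m : ℝ} (hA : 0 < A) (hθ : 0 < θ) (hP : 0 < P)
    (hs : 0 < s) (hL : 0 < L) (hm : 0 < m) (hwin : P ^ 2 ≤ 12 * Real.pi ^ 2 * κ ^ 2 * s ^ 2)
    (hlat : 2 * Real.pi * m / L ≤ P) :
    A * (P ^ 2 + s ^ 2) / (2 * θ * s * P) ≤
      A * (6 * Real.pi * κ ^ 2 + 1 / (2 * Real.pi)) / (2 * θ) * s * L / m := by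
  have hπ : 0 < Real.pi := Real.pi_pos
  -- `1/P ≤ L/(2π m)`
  have hinv : 1 / P ≤ L / (2 * Real.pi * m) := by
    rw [div_le_div_iff₀ hP (by positivity), one_mul]
    calc 2 * Real.pi * m = 2 * Real.pi * m / L * L := by field_simp
      _ ≤ P * L := by gcongr
      _ = L * P := mul_comm _ _
  -- `P/s ≤ 12π²κ² s/P ≤ 6πκ² sL/m`
  have h1 : P / s ≤ 6 * Real.pi * κ ^ 2 * s * L / m := by
    have hPs : P / s ≤ 12 * Real.pi ^ 2 * κ ^ 2 * s * (1 / P) := by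
      rw [div_le_iff₀ hs]
      have : 12 * Real.pi ^ 2 * κ ^ 2 * s * (1 / P) * s = 12 * Real.pi ^ 2 * κ ^ 2 * s ^ 2 / P := by
        field_simp
      rw [this, le_div_iff₀ hP]
      nlinarith
    calc P / s ≤ 12 * Real.pi ^ 2 * κ ^ 2 * s * (1 / P) := hPs
      _ ≤ 12 * Real.pi ^ 2 * κ ^ 2 * s * (L / (2 * Real.pi * m)) := by gcongr
      _ = 6 * Real.pi * κ ^ 2 * s * L / m := by field_simp; ring
  -- `s/P ≤ sL/(2π m)`
  have h2 : s / P ≤ s * L / (2 * Real.pi * m) := by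
    calc s / P = s * (1 / P) := by ring
      _ ≤ s * (L / (2 * Real.pi * m)) := by gcongr
      _ = s * L / (2 * Real.pi * m) := by ring
  have key : A * (P ^ 2 + s ^ 2) / (2 * θ * s * P) = A / (2 * θ) * (P / s + s / P) := by
    field_simp
  rw [key]
  calc A / (2 * θ) * (P / s + s / P)
      ≤ A / (2 * θ) * (6 * Real.pi * κ ^ 2 * s * L / m + s * L / (2 * Real.pi * m)) := by
        gcongr
    _ = A * (6 * Real.pi * κ ^ 2 + 1 / (2 * Real.pi)) / (2 * θ) * s * L / m := by
        field_simp

/-! ## Stub 6 -/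

/-- **Stub 6 — the NON-INTEGRABLE half** (reshaped statement, wave 2): for an admissible `v` with
`∫v = ⊤`, the hard-core (dressed) Wagner–Feynman moment bound ON THE WINDOW (for every window constant
`C` some `A, ρ₁`) and the linear particle–hole floor `C⁺` for `v` give the crux for `v` in γ-form:
window `‖k‖_∞ ≤ κ√ρL_N` ⇒ `‖p‖² ≤ 12π²κ²ρ` for `p = 2πk/L_N`; both the floor and the moment bound are
taken at `C := 12π²κ²`; the floor gives `θ := 2θ₀√ρ‖p‖`; the moment bound gives
`γ_N(k) ≤ A(‖p‖² + ρ)/(2θ₀√ρ‖p‖) ≤ C'√ρL_N/‖k‖_∞`, `C' = A(6πκ² + 1/(2π))/(2θ₀)`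
(`‖p‖ ≥ 2π‖k‖_∞/L_N`), for `ρ < min ρ₀ ρ₁`. [folklore] -/
theorem stub_hardCore : HardCoreHalf := by
  intro v _hv _htop hmom hfloor κ hκ
  have hCfl : 0 < 12 * Real.pi ^ 2 * κ ^ 2 := by positivity
  obtain ⟨A, hA, ρ₁, hρ₁, hmom⟩ := hmom _ hCfl
  obtain ⟨θ₀, hθ₀, ρf, hρf, hfl⟩ := hfloor _ hCfl
  set C' : ℝ := A * (6 * Real.pi * κ ^ 2 + 1 / (2 * Real.pi)) / (2 * θ₀) with hC'
  have hC'pos : 0 < C' := by positivity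
  refine ⟨min ρf ρ₁, lt_min hρf hρ₁, C', hC'pos, fun ρ hρ hρ0 => ?_⟩
  filter_upwards [hfl ρ hρ (hρ0.trans_le (min_le_left _ _)),
    hmom ρ hρ (hρ0.trans_le (min_le_right _ _)), eventually_gt_atTop 0] with N hflN hmomN hNpos
  intro k hk
  have hL : 0 < sideLength ρ N := sideLength_pos_of_pos hρ hNpos
  have hs : 0 < Real.sqrt ρ := Real.sqrt_pos.2 hρ
  have hm1 : 1 ≤ ‖(fun j => (k j : ℝ))‖ := one_le_norm_intVec hk.1
  have hm : 0 < ‖(fun j => (k j : ℝ))‖ := lt_of_lt_of_le one_pos hm1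
  have hπ : 0 < Real.pi := Real.pi_pos
  -- the dual-lattice momentum `p = 2πk/L_N`
  set p : Space := latticeVec (2 * Real.pi / sideLength ρ N) k with hp
  have hc : 0 < 2 * Real.pi / sideLength ρ N := by positivity
  -- `2π‖k‖_∞/L ≤ ‖p‖`
  have hlat : 2 * Real.pi * ‖(fun j => (k j : ℝ))‖ / sideLength ρ N ≤ ‖p‖ := by
    have := abs_mul_norm_intVec_le_norm_latticeVec (2 * Real.pi / sideLength ρ N) k
    rw [abs_of_pos hc] at this
    calc 2 * Real.pi * ‖(fun j => (k j : ℝ))‖ / sideLength ρ N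
        = 2 * Real.pi / sideLength ρ N * ‖(fun j => (k j : ℝ))‖ := by ring
      _ ≤ ‖p‖ := this
  have hPpos : 0 < ‖p‖ := lt_of_lt_of_le (by positivity) hlat
  have hp0 : p ≠ 0 := norm_pos_iff.1 hPpos
  -- window: `‖p‖² ≤ 12π²κ²ρ`
  have hwin : ‖p‖ ^ 2 ≤ 12 * Real.pi ^ 2 * κ ^ 2 * Real.sqrt ρ ^ 2 := by
    have h1 := norm_latticeVec_sq_le (2 * Real.pi / sideLength ρ N) k
    have h2 : ‖(fun j => (k j : ℝ))‖ ^ 2 ≤ (κ * Real.sqrt ρ * sideLength ρ N) ^ 2 :=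
      pow_le_pow_left₀ (norm_nonneg _) hk.2 2
    calc ‖p‖ ^ 2 ≤ 3 * (2 * Real.pi / sideLength ρ N) ^ 2 * ‖(fun j => (k j : ℝ))‖ ^ 2 := h1
      _ ≤ 3 * (2 * Real.pi / sideLength ρ N) ^ 2 * (κ * Real.sqrt ρ * sideLength ρ N) ^ 2 := by
          gcongr
      _ = 12 * Real.pi ^ 2 * κ ^ 2 * Real.sqrt ρ ^ 2 := by
          field_simp
          norm_num
  have hwin' : ‖p‖ ^ 2 ≤ 12 * Real.pi ^ 2 * κ ^ 2 * ρ := by rwa [Real.sq_sqrt hρ.le] at hwin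
  -- the floor at `p`, then the moment bound (window mode!) with `θ := 2θ₀√ρ‖p‖`
  have hθ : 0 ≤ 2 * θ₀ * Real.sqrt ρ * ‖p‖ := by positivity
  have hθpos : 0 < 2 * θ₀ * Real.sqrt ρ * ‖p‖ := by positivity
  have hγ := hmomN k hk.1 hwin' _ hθ (hflN p hp0 hwin')
  -- divide
  set D : ℝ := A * (‖p‖ ^ 2 + ρ) with hD
  have hdiv : groundOccupation v N (sideLength ρ N) k ≤
      ENNReal.ofReal (D / (2 * θ₀ * Real.sqrt ρ * ‖p‖)) := by
    rw [ENNReal.ofReal_div_of_pos hθpos]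
    exact (ENNReal.le_div_iff_mul_le (Or.inl ((ENNReal.ofReal_pos.2 hθpos).ne'))
      (Or.inl ENNReal.ofReal_ne_top)).2 hγ
  refine hdiv.trans (ENNReal.ofReal_le_ofReal ?_)
  -- real arithmetic
  have key := transfer_arith (κ := κ) hA hθ₀ hPpos hs hL hm hwin hlat
  have hD' : D = A * (‖p‖ ^ 2 + Real.sqrt ρ ^ 2) := by rw [hD, Real.sq_sqrt hρ.le]
  rw [hD']
  calc A * (‖p‖ ^ 2 + Real.sqrt ρ ^ 2) / (2 * θ₀ * Real.sqrt ρ * ‖p‖)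
      ≤ A * (6 * Real.pi * κ ^ 2 + 1 / (2 * Real.pi)) / (2 * θ₀) * Real.sqrt ρ *
          sideLength ρ N / ‖(fun j => (k j : ℝ))‖ := key
    _ = C' * Real.sqrt ρ * sideLength ρ N / ‖(fun j => (k j : ℝ))‖ := by rw [hC']

end Summit.AtomisticToContinuum.BoseEinsteinCondensation.Cruxes.PeriodicIRBound.LinearPhFloorWagner

end
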